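import Summits.NavierStokesRegularity.FluidComputer.ClayBlowupLocalZoom
import Summits.NavierStokesRegularity.FluidComputer.ClayBlowupLocalAlignment
import Literature.Analysis.FluidPDE.BlowupAncientSolution
import Literature.Analysis.FluidPDE.KNSSTypeIRateMildProofs
import Literature.Analysis.FluidPDE.NSLerayHopfSereginStability
import Literature.Analysis.FluidPDE.GigaMiura2011ScaledAlignmentBlowupLimitHolds
import HarnessLib

/-!
# EVERY SINGULAR POINT OF A CLAY BLOW-UP, WITH ITS CLAY FORCE, CARRIES A KNSS BLOW-UP LIMIT
# (`IsKNSSBlowupLimit`, the tree's normal form: `sup |v| = 1`)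

Cell `ns-blowup`, seat `ns-blowup-ecbridge-2` (g11; the E–C endpoint theory seat). LABEL: E–C typing
(KERNEL — no named fact, no new definition). WHAT THIS IS NOT: not Navier–Stokes evidence — a
necessary STRUCTURE at each singular point of the TYPE `ClayBlowup 1`; no inhabitant is claimed.
Companion memo: `run/shared/lean/pub/ns-blowup/ecbridge2/ECBRIDGE-2-MEMO-10.md` (§4 (c)).

## Content

`ClayBlowup.exists_local_zoom_limit` produces, at a prescribed singular point `x₁`, a nontrivial
bounded ancient mild limit `W` with `‖W‖ ≤ 4` and `‖W(s, 0)‖ ≥ 1/2` near `s = 0`. The tree's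
dictionary for blow-up limits (`IsKNSSBlowupLimit`: bounded ancient mild solution at `ν = 1`,
measurable slices, smooth on `(−∞, 0) × ℝ³`, `|v| ≤ 1`, `sup |v| = 1`) wants the normal form
`sup |v| = 1`; the Navier–Stokes scaling `v(s, z) = c W(c² s, c z)` with `c = (sup |W|)⁻¹ ∈ [1/4, 2]`
provides it (`oseen_smul_stPull`, `IsWeaklyDivFree.dilate`,
`smooth_and_bounds_of_bounded_ancient_oseenMild`), and `v` is still a blow-up limit of `u` at `x₁`,
with amplitudes `a_j = c M_j⁻¹`.

* **`ClayBlowup.exists_isKNSSBlowupLimit_local`** — for `X : ClayBlowup 1`, a point `x₁` NOT backward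
  bounded, `0 < r' ≤ 1`, `t_b ∈ [0, T)`: centres `τ_k ∈ [t_b, T)`, `y_k ∈ B(x₁, r')` with
  `‖u(τ_k, y_k)‖ ≥ k + 1`, a subsequence `φ`, amplitudes `a_j > 0`, `a_j → 0`, and
  `v : ℝ → ℝ³ → ℝ³` with `IsKNSSBlowupLimit v` such that
  `a_j u(τ_{φ j} + a_j² s, y_{φ j} + a_j z) → v(s, z)` for all `s < 0`, `z`. Every theorem of the tree
  consuming `IsKNSSBlowupLimit` therefore applies at EVERY singular point, with the force.

References: Koch–Nadirashvili–Seregin–Šverák, Acta Math. 203 (2009), Prop 6.1, §1 (1.2)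
[cite: KochNadirashviliSereginSverak2009, Prop 6.1]; C. L. Fefferman, (C) [cite: FeffermanClay2006, (C)].
-/

noncomputable section

namespace Summit.NavierStokesRegularity.FluidComputer

open Set MeasureTheory Filter Topology Function Metric
open scoped ENNReal NNReal
open Literature.Analysis Literature.Analysis.FluidPDE
open Summit.NavierStokesRegularity.NavierStokesRegularity

namespace ClayBlowup

set_option maxHeartbeats 400000 in
-- the normal form needs a dozen covariance rewrites under binders
/-- **EVERY SINGULAR POINT CARRIES A KNSS BLOW-UP LIMIT, WITH THE CLAY FORCE** (`ν = 1`; no named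
fact): see the module docstring. [cite: KochNadirashviliSereginSverak2009, Prop 6.1] -/
theorem exists_isKNSSBlowupLimit_local (X : ClayBlowup 1) {x₁ : EuclideanSpace ℝ (Fin 3)}
    (hx₁ : ¬ IsBackwardBoundedAt X.u X.T x₁) {r' t_b : ℝ} (hr' : 0 < r') (hr'1 : r' ≤ 1)
    (ht_b : t_b ∈ Ico 0 X.T) :
    ∃ (τ : ℕ → ℝ) (y : ℕ → EuclideanSpace ℝ (Fin 3)) (φ : ℕ → ℕ) (a : ℕ → ℝ)
      (v : ℝ → EuclideanSpace ℝ (Fin 3) → EuclideanSpace ℝ (Fin 3)),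
      StrictMono φ ∧ (∀ k, τ k ∈ Ico t_b X.T) ∧ (∀ k, y k ∈ ball x₁ r') ∧
      (∀ k : ℕ, (k : ℝ) + 1 ≤ ‖X.u (τ k) (y k)‖) ∧ (∀ j, 0 < a j) ∧ Tendsto a atTop (𝓝 0) ∧
      IsKNSSBlowupLimit v ∧
      ∀ s < 0, ∀ z, Tendsto (fun j => a j • X.u (τ (φ j) + a j ^ 2 * s) (y (φ j) + a j • z))
        atTop (𝓝 (v s z)) := by
  obtain ⟨τ, y, φ, W, hφ, hτ, hy, hk1, hWc, hWdiv, hWmild, hW4, ⟨σ₁, hσ₁, hhalf⟩, hconv⟩ :=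
    X.exists_local_zoom_limit hx₁ hr' hr'1 ht_b
  obtain ⟨cc, hcc⟩ : ∃ cc : ℕ → ℝ, ∀ k, cc k = ‖X.u (τ k) (y k)‖⁻¹ := ⟨_, fun k => rfl⟩
  simp_rw [← hcc] at hconv
  have hM0 : ∀ k, 0 < ‖X.u (τ k) (y k)‖ := fun k => lt_of_lt_of_le (by positivity) (hk1 k)
  have hcc0 : ∀ k, 0 < cc k := fun k => by rw [hcc k]; exact inv_pos.2 (hM0 k)
  have hccto : Tendsto cc atTop (𝓝 0) := by
    have hMto : Tendsto (fun k => ‖X.u (τ k) (y k)‖) atTop atTop := by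
      refine tendsto_atTop_atTop.2 fun B => ⟨⌈B⌉₊, fun k hk => ?_⟩
      have h1 : (⌈B⌉₊ : ℝ) ≤ k := by exact_mod_cast hk
      linarith [Nat.le_ceil B, hk1 k]
    exact (tendsto_inv_atTop_zero.comp hMto).congr fun k => by simp [Function.comp, hcc k]
  -- ### the supremum `L = sup |W| ∈ [1/2, 4]`
  set S : Set ℝ := (fun p : ℝ × EuclideanSpace ℝ (Fin 3) => ‖W p.1 p.2‖) '' (Iio 0 ×ˢ univ) with hS
  have hSbdd : BddAbove S := ⟨4, by rintro _ ⟨p, hp, rfl⟩; exact hW4 p.1 hp.1 p.2⟩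
  have hWL : ∀ s < 0, ∀ z, ‖W s z‖ ≤ sSup S := fun s hs z =>
    le_csSup hSbdd ⟨(s, z), ⟨hs, mem_univ _⟩, rfl⟩
  have hSne : S.Nonempty := ⟨_, ⟨(-(σ₁ / 2), 0), ⟨by show -(σ₁ / 2) < 0; linarith, mem_univ _⟩, rfl⟩⟩
  set L : ℝ := sSup S with hL
  have hL2 : 1 / 2 ≤ L := (hhalf (-(σ₁ / 2)) ⟨by linarith, by linarith⟩).trans (hWL _ (by linarith) 0)
  have hL0 : 0 < L := by linarith
  have happrox : ∀ ε : ℝ, 0 < ε → ∃ s < 0, ∃ z, L - ε < ‖W s z‖ := by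
    intro ε hε
    obtain ⟨_, ⟨p, hp, rfl⟩, hlt⟩ := exists_lt_of_lt_csSup hSne (show L - ε < L by linarith)
    exact ⟨p.1, hp.1, p.2, hlt⟩
  -- ### the normalised limit `v(s, z) = c W(c² s, c z)`, `c = L⁻¹`
  set c : ℝ := L⁻¹ with hc
  have hc0 : 0 < c := inv_pos.2 hL0
  have hcL : c * L = 1 := inv_mul_cancel₀ hL0.ne'
  set v : ℝ → EuclideanSpace ℝ (Fin 3) → EuclideanSpace ℝ (Fin 3) :=
    c • stPull (c ^ 2) c 0 0 W with hv
  have hv_apply : ∀ s z, v s z = c • W (c ^ 2 * s) (c • z) := fun s z => by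
    show c • W (0 + c ^ 2 * s) (0 + c • z) = _
    rw [zero_add, zero_add]
  have hneg : ∀ s < 0, c ^ 2 * s < 0 := fun s hs => mul_neg_of_pos_of_neg (pow_pos hc0 2) hs
  have hvbd : ∀ s < 0, ∀ z, ‖v s z‖ ≤ 1 := by
    intro s hs z
    rw [hv_apply, norm_smul, Real.norm_of_nonneg hc0.le]
    calc c * ‖W (c ^ 2 * s) (c • z)‖ ≤ c * L :=
          mul_le_mul_of_nonneg_left (hWL _ (hneg s hs) _) hc0.le
      _ = 1 := hcL
  have hvcont : ContinuousOn (uncurry v) (Iio 0 ×ˢ univ) := by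
    have hA : Continuous fun p : ℝ × EuclideanSpace ℝ (Fin 3) => (0 + c ^ 2 * p.1, 0 + c • p.2) := by
      fun_prop
    have hmaps : MapsTo (fun p : ℝ × EuclideanSpace ℝ (Fin 3) => (0 + c ^ 2 * p.1, 0 + c • p.2))
        (Iio 0 ×ˢ univ) (Iio 0 ×ˢ univ) := fun p hp =>
      ⟨by show 0 + c ^ 2 * p.1 < 0; rw [zero_add]; exact hneg p.1 hp.1, mem_univ _⟩
    have h := (hWc.comp hA.continuousOn hmaps).const_smul c
    exact h
  have hvdiv : ∀ s < 0, IsWeaklyDivFree (v s) := by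
    intro s hs
    have e : v s = fun z => c • W (c ^ 2 * s) (c • z) := funext (hv_apply s)
    rw [e]
    exact (hWdiv _ (hneg s hs)).dilate hc0 c
  have hvmild : ∀ σ θ : ℝ, σ < θ → θ < 0 → ∀ z,
      v θ z = UnboundedOperators.heatExtension (v σ) (θ - σ) z - oseenDuhamel 1 σ v v θ z := by
    intro σ θ hσθ hθ z
    have hlt : 0 + c ^ 2 * σ < 0 + c ^ 2 * θ := by nlinarith [pow_pos hc0 2]
    have hθ' : 0 + c ^ 2 * θ < 0 := by rw [zero_add]; exact hneg θ hθ
    exact oseen_smul_stPull hc0 0 0 hσθ (fun X' => hWmild _ _ hlt hθ' X') z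
  have hvanc : IsBoundedAncientMildSolution 1 v :=
    isBoundedAncientMildSolution_of_oseen one_pos hvcont ⟨1, hvbd⟩ hvdiv
      (fun σ θ hσθ hθ z => by rw [one_mul]; exact hvmild σ θ hσθ hθ z)
  obtain ⟨hvsm, -⟩ := smooth_and_bounds_of_bounded_ancient_oseenMild hvcont hvdiv hvmild hvbd
  have hvslice : ∀ s < 0, Continuous (v s) := fun s hs =>
    hvcont.comp_continuous (Continuous.prodMk_right s) fun z => ⟨hs, mem_univ z⟩
  have hknss : IsKNSSBlowupLimit v := by
    refine ⟨hvanc, fun s hs => (hvslice s hs).aestronglyMeasurable, hvsm, hvbd, fun ε hε => ?_⟩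
    obtain ⟨s', hs', z', hlt⟩ := happrox (ε * L) (by positivity)
    refine ⟨s' / c ^ 2, div_neg_of_neg_of_pos hs' (pow_pos hc0 2), c⁻¹ • z', ?_⟩
    rw [hv_apply, mul_div_cancel₀ _ (pow_pos hc0 2).ne', smul_smul, mul_inv_cancel₀ hc0.ne',
      one_smul, norm_smul, Real.norm_of_nonneg hc0.le]
    calc 1 - ε = c * (L - ε * L) := by
          rw [mul_sub, hcL]; rw [hc]; field_simp
      _ < c * ‖W s' z'‖ := mul_lt_mul_of_pos_left hlt hc0
  -- ### the amplitudes `a_j = c M_{φ j}⁻¹` and the convergence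
  refine ⟨τ, y, φ, fun j => c * cc (φ j), v, hφ, hτ, hy, hk1, fun j => mul_pos hc0 (hcc0 _), ?_,
    hknss, fun s hs z => ?_⟩
  · simpa using (hccto.comp hφ.tendsto_atTop).const_mul c
  · have h := (hconv (0 + c ^ 2 * s) (by rw [zero_add]; exact hneg s hs) (0 + c • z)).const_smul c
    have e : ∀ j, (c * cc (φ j)) • X.u (τ (φ j) + (c * cc (φ j)) ^ 2 * s)
        (y (φ j) + (c * cc (φ j)) • z) =
        c • (cc (φ j) • X.u (τ (φ j) + cc (φ j) ^ 2 * (0 + c ^ 2 * s))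
          (y (φ j) + cc (φ j) • (0 + c • z))) := by
      intro j
      rw [smul_smul, zero_add, zero_add, smul_smul]
      congr 2
      · ring
      · rw [mul_comm]
    simp_rw [e]
    have ev : v s z = c • W (0 + c ^ 2 * s) (0 + c • z) := rfl
    rw [ev]
    exact h

/-- **EVERY SINGULAR POINT CARRIES A KNSS BLOW-UP LIMIT, WITH THE CLAY FORCE — every viscosity**
(`ν > 0`; no named fact): for `X : ClayBlowup ν` and a point `x₁` which is NOT backward bounded,
`0 < r' ≤ 1`: centres `t_k ∈ (0, T)`, `y_k ∈ B(x₁, r')`, a subsequence `φ`, amplitudes `a_j > 0`,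
`a_j → 0`, and `v` with `IsKNSSBlowupLimit v` such that the viscosity-normalised zooms
`(a_j/ν) u(t_{φ j} + a_j² s/ν, y_{φ j} + a_j z)` converge to `v(s, z)` for all `s < 0`, `z`
(through `rescale`, a pure time dilation, and `isBackwardBoundedAt_of_rescale`; appended, g11). [cite: KochNadirashviliSereginSverak2009, Prop 6.1] -/
theorem exists_isKNSSBlowupLimit_local_of_pos {ν : ℝ} (X : ClayBlowup ν) (hν : 0 < ν)
    {x₁ : EuclideanSpace ℝ (Fin 3)} (hx₁ : ¬ IsBackwardBoundedAt X.u X.T x₁) {r' : ℝ}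
    (hr' : 0 < r') (hr'1 : r' ≤ 1) :
    ∃ (t : ℕ → ℝ) (y : ℕ → EuclideanSpace ℝ (Fin 3)) (φ : ℕ → ℕ) (a : ℕ → ℝ)
      (v : ℝ → EuclideanSpace ℝ (Fin 3) → EuclideanSpace ℝ (Fin 3)),
      StrictMono φ ∧ (∀ k, t k ∈ Ioo 0 X.T) ∧ (∀ k, y k ∈ ball x₁ r') ∧ (∀ j, 0 < a j) ∧
      Tendsto a atTop (𝓝 0) ∧ IsKNSSBlowupLimit v ∧
      ∀ s < 0, ∀ z, Tendsto
        (fun j => (a j / ν) • X.u (t (φ j) + a j ^ 2 * s / ν) (y (φ j) + a j • z))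
        atTop (𝓝 (v s z)) := by
  set Y : ClayBlowup 1 := X.rescale hν one_pos with hY
  have hresc : ¬ IsBackwardBoundedAt Y.u Y.T x₁ := fun h =>
    hx₁ (X.isBackwardBoundedAt_of_rescale hν one_pos h)
  have hYT : Y.T = X.T / (1 / ν) := X.rescale_T hν one_pos
  have hYu : ∀ s z, Y.u s z = (1 / ν) • X.u (1 / ν * s) z := fun s z => X.rescale_u_apply hν one_pos s z
  have hTY : 0 < Y.T := Y.T_pos
  have ht_b : Y.T / 2 ∈ Ico 0 Y.T := ⟨by positivity, by linarith⟩
  obtain ⟨τ, y, φ, a, v, hφ, hτ, hy, -, ha0, hato, hknss, hconv⟩ :=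
    Y.exists_isKNSSBlowupLimit_local hresc hr' hr'1 ht_b
  refine ⟨fun k => 1 / ν * τ k, y, φ, a, v, hφ, fun k => ⟨?_, ?_⟩, hy, ha0, hato, hknss,
    fun s hs z => ?_⟩
  · have h1 : 0 < τ k := lt_of_lt_of_le (by positivity) (hτ k).1
    positivity
  · have h2 : τ k < X.T / (1 / ν) := hYT ▸ (hτ k).2
    rw [lt_div_iff₀ (by positivity)] at h2
    linarith [mul_comm (τ k) (1 / ν)]
  · refine (hconv s hs z).congr fun j => ?_
    have e1 : a j / ν = a j * (1 / ν) := div_eq_mul_one_div (a j) ν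
    have e2 : 1 / ν * τ (φ j) + a j ^ 2 * s / ν = 1 / ν * (τ (φ j) + a j ^ 2 * s) := by ring
    rw [hYu, smul_smul, e1, e2]

end ClayBlowup

end Summit.NavierStokesRegularity.FluidComputer

end
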